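import Mathlib
import Summits.ValiantsHypothesis.ValiantsHypothesis.Theorems.KPlusLogSqLawWeakLiftingTowerGraftFibreRealitySigned
import Summits.ValiantsHypothesis.ValiantsHypothesis.Theorems.LacunarySymmetroidMatrixDescartesGramDualHaynsworth

/-!
# Tower graft line — T3 structure: fibre reality for RANK-DEFICIENT far letters — signed flux through the Schur complement
# (Haynsworth) and NO FOLD OVER THE DEFINITE ZONE for far letters of every rank

Sequel to `…TowerGraftFibreReality.lean` (§3: degree = rank, flux `≥ |p − q|` for `S₀ ⊕ 0`) and `…TowerGraftFibreRealitySigned.lean`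
(signed flux through `T = 0`, definite base ⇒ totally real) — same seat, LINE (B) `Cruxes/WeakLifting/Lines/tower_graft.lean`, crux `WeakLifting`
(stmt-ValiantsHypothesis-19561), memo `tower_graft-S5.md` §1 (Ed)/(Er), §3 T3.  NO stub is claimed.

Far letter in normal form `0 ⊕ S₀` (the zero block FIRST, on the index type `p`; `S₀ : n × n` non-singular of indices `(p₀, q₀)`, `p₀ + q₀ = ` rank),
base `G = [[A, B], [Bᵀ, D]]` with the complementary block `A` non-singular (off the `(Er)` events).  Then (§1, `det_fibre_zeroFirst_eq`)
`det (X·(0 ⊕ S₀) + G) = C(det A) · det (X·S₀ + Σ)` with the Schur complement `Σ = D − BᵀA⁻¹B` (row clearing by `[[1,0],[−BᵀA⁻¹,1]]`), and: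
* §2 SIGNED FLUX (`card_posRoots_fibre_ge_zeroFirst`): if also `G` is non-singular (off `(E0)`), `#{T > 0 : det = 0} ≥ |ν(S₀) + ν(A) − ν(G)|` — the
  index of the Schur complement is `ν(Σ) = ν(G) − ν(A)` by HAYNSWORTH (tree `GramDual.negIndex_fromBlocks_eq`, mdr-p2 g19);
* §3 DEFINITE BASE (`card_roots_fibre_eq_rank_of_posDef_zeroFirst`): if `G ≻ 0` then `Σ ≻ 0` (`GramDual.form_fromBlocks` at `x = −A⁻¹By`) and the
  fibre polynomial — of degree = rank — is TOTALLY REAL with exactly `ν(S₀)` positive and `π(S₀)` negative roots: NO FAR LETTER OF ANY RANK FOLDS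
  OVER A POINT WHERE THE CLASS PENCIL `G(t)` IS POSITIVE DEFINITE (and, by `G ↦ −G`, negative definite).
HONEST FRAMING: structure of the fibres; the number of folds over the indefinite zone is not bounded (located: ≥ 12 at (3,3), ≥ 19 at (4,3) for
signature (2,1), memo `T3-RANK3-liftp2g22.md`); nothing on S4/S4b/S5, TowerB, `WeakLifting`, Conjecture B, `MatrixDescartes` (18050) or
VP ≠ VNP.  Def-free; Mathlib + the two prequels + the Haynsworth file.  Seat: prover val-sym-lift-p2 g22, `--supports stmt-ValiantsHypothesis-19561 --as helper`.
-/

-- `Summit.ValiantsHypothesis.ValiantsHypothesis.…` repeats a component by the D-0017 layout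
-- (single-conjunct summit), which the `dupNamespace` linter flags; the name is mandated.
set_option linter.dupNamespace false

namespace Summit.ValiantsHypothesis.ValiantsHypothesis.Theorems.KPlusLogSqLaw.TowerGraft

open Polynomial Matrix Finset
open scoped BigOperators
open Summit.ValiantsHypothesis.ValiantsHypothesis.Theorems.LacunarySymmetroidMatrixDescartes
open Summit.ValiantsHypothesis.ValiantsHypothesis.Theorems.LacunarySymmetroidMatrixDescartes.Inertia
open Summit.ValiantsHypothesis.ValiantsHypothesis.Theorems.LacunarySymmetroidMatrixDescartes.GramDual

variable {p n : Type} [Fintype p] [DecidableEq p] [Fintype n] [DecidableEq n]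

/-! ## §1 Schur reduction with the zero block first -/

/-- **Schur reduction, zero block first.**  `det (X·(0 ⊕ S₀) + [[A,B],[Bᵀ,D]]) = C(det A) · det (X·S₀ + (D − BᵀA⁻¹B))` for `A` non-singular
(row clearing by the constant block multiplier `[[1, 0], [−BᵀA⁻¹, 1]]`). [folklore] -/
theorem det_fibre_zeroFirst_eq (A : Matrix p p ℝ) (B : Matrix p n ℝ) (D S₀ : Matrix n n ℝ) (hAdet : A.det ≠ 0) :
    ((X : ℝ[X]) • (fromBlocks (0 : Matrix p p ℝ) 0 0 S₀).map C + (fromBlocks A B Bᵀ D).map C).det =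
      C A.det * ((X : ℝ[X]) • S₀.map C + (D - Bᵀ * A⁻¹ * B).map C).det := by
  have hAA : A⁻¹ * A = 1 := Matrix.nonsing_inv_mul A (isUnit_iff_ne_zero.mpr hAdet)
  have hM : (X : ℝ[X]) • (fromBlocks (0 : Matrix p p ℝ) 0 0 S₀).map C + (fromBlocks A B Bᵀ D).map C =
      fromBlocks (A.map C) (B.map C) (Bᵀ.map C) ((X : ℝ[X]) • S₀.map C + D.map C) := by
    rw [fromBlocks_map, fromBlocks_map, fromBlocks_smul, fromBlocks_add]
    simp [Matrix.map_zero C C_0]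
  have hP : fromBlocks 1 0 (-(Bᵀ * A⁻¹).map C) 1 * fromBlocks (A.map C) (B.map C) (Bᵀ.map C) ((X : ℝ[X]) • S₀.map C + D.map C) =
      fromBlocks (A.map C) (B.map C) 0 ((X : ℝ[X]) • S₀.map C + (D - Bᵀ * A⁻¹ * B).map C) := by
    rw [fromBlocks_multiply]
    simp only [Matrix.one_mul, Matrix.zero_mul, add_zero, Matrix.neg_mul]
    congr 1
    · rw [← Matrix.map_mul, Matrix.mul_assoc, hAA, Matrix.mul_one, neg_add_cancel]
    · rw [← Matrix.map_mul, Matrix.map_sub C (map_sub C)]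
      abel
  have hdetP : (fromBlocks (1 : Matrix p p ℝ[X]) 0 (-(Bᵀ * A⁻¹).map C) 1).det = 1 := by
    rw [det_fromBlocks_zero₁₂, det_one, det_one, mul_one]
  have h := congrArg Matrix.det hP
  rw [det_mul, hdetP, one_mul, det_fromBlocks_zero₂₁] at h
  have hAmap : (A.map C).det = C A.det := by rw [RingHom.map_det, RingHom.mapMatrix_apply]
  rw [hM, h, hAmap]

omit [Fintype n] [DecidableEq n] in
/-- the Schur complement `D − BᵀA⁻¹B` of a symmetric block matrix is symmetric. [folklore] -/
theorem isSymm_schur' (A : Matrix p p ℝ) (B : Matrix p n ℝ) (D : Matrix n n ℝ) (hA : A.IsSymm) (hD : D.IsSymm) :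
    (D - Bᵀ * A⁻¹ * B).IsSymm := by
  have hAi : (A⁻¹)ᵀ = A⁻¹ := by rw [Matrix.transpose_nonsing_inv, hA.eq]
  rw [Matrix.IsSymm, Matrix.transpose_sub, hD.eq, Matrix.transpose_mul, Matrix.transpose_mul, Matrix.transpose_transpose, hAi,
    Matrix.mul_assoc]

omit [Fintype p] [DecidableEq p] [Fintype n] [DecidableEq n] in
/-- the symmetric block matrix. [folklore] -/
theorem isSymm_fromBlocks' (A : Matrix p p ℝ) (B : Matrix p n ℝ) (D : Matrix n n ℝ) (hA : A.IsSymm) (hD : D.IsSymm) :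
    (fromBlocks A B Bᵀ D).IsSymm := by
  rw [Matrix.IsSymm, fromBlocks_transpose, transpose_transpose, hA.eq, hD.eq]

/-- `det [[A,B],[Bᵀ,D]] = det A · det (D − BᵀA⁻¹B)`; in particular `G` non-singular ⇒ Schur complement non-singular. [folklore] -/
theorem det_schur'_ne_zero (A : Matrix p p ℝ) (B : Matrix p n ℝ) (D : Matrix n n ℝ) (hAdet : A.det ≠ 0)
    (hGdet : (fromBlocks A B Bᵀ D).det ≠ 0) : (D - Bᵀ * A⁻¹ * B).det ≠ 0 := by
  haveI := Matrix.invertibleOfIsUnitDet A (isUnit_iff_ne_zero.mpr hAdet)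
  rw [Matrix.det_fromBlocks₁₁, Matrix.invOf_eq_nonsing_inv] at hGdet
  exact right_ne_zero_of_mul hGdet

/-! ## §2 Signed flux through the Schur complement (Haynsworth) -/

/-- **SIGNED FLUX FOR A RANK-DEFICIENT LETTER.**  Far letter `0 ⊕ S₀` (`S₀` non-singular), base `G = [[A,B],[Bᵀ,D]]` symmetric with `A` and `G`
non-singular.  Then `#{T > 0 : det (T·(0 ⊕ S₀) + G) = 0} ≥ |ν(S₀) + ν(A) − ν(G)|` with multiplicity — the positive half-line flux of the
prequel for the Schur complement `Σ = D − BᵀA⁻¹B`, whose index is `ν(G) − ν(A)` by Haynsworth. [this work] -/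
theorem card_posRoots_fibre_ge_zeroFirst (A : Matrix p p ℝ) (B : Matrix p n ℝ) (D S₀ : Matrix n n ℝ)
    (hA : A.IsSymm) (hD : D.IsSymm) (hS₀ : S₀.IsSymm) (hAdet : A.det ≠ 0) (hS₀det : S₀.det ≠ 0)
    (hGdet : (fromBlocks A B Bᵀ D).det ≠ 0) :
    Nat.dist (Fintype.card {j // (isHermitian_of_isSymm hS₀).eigenvalues j < 0} +
        Fintype.card {j // (isHermitian_of_isSymm hA).eigenvalues j < 0})
      (Fintype.card {j // (isHermitian_of_isSymm (isSymm_fromBlocks' A B D hA hD)).eigenvalues j < 0})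
      ≤ Multiset.card ((((X : ℝ[X]) • (fromBlocks (0 : Matrix p p ℝ) 0 0 S₀).map C + (fromBlocks A B Bᵀ D).map C).det).roots.filter
          (fun T => 0 < T)) := by
  have hScs : (D - Bᵀ * A⁻¹ * B).IsSymm := isSymm_schur' A B D hA hD
  have hScdet : (D - Bᵀ * A⁻¹ * B).det ≠ 0 := det_schur'_ne_zero A B D hAdet hGdet
  have hflux := card_posRoots_fibre_ge (D - Bᵀ * A⁻¹ * B) S₀ hScs hS₀ hScdet hS₀det
  have hH := negIndex_fromBlocks_eq hA (isUnit_iff_ne_zero.mpr hAdet) B D (isHermitian_of_isSymm hA) (isHermitian_of_isSymm hScs)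
    (isHermitian_of_isSymm (isSymm_fromBlocks' A B D hA hD))
  rw [det_fibre_zeroFirst_eq A B D S₀ hAdet, Polynomial.roots_C_mul _ hAdet]
  have e : Nat.dist (Fintype.card {j // (isHermitian_of_isSymm hS₀).eigenvalues j < 0} +
        Fintype.card {j // (isHermitian_of_isSymm hA).eigenvalues j < 0})
      (Fintype.card {j // (isHermitian_of_isSymm (isSymm_fromBlocks' A B D hA hD)).eigenvalues j < 0}) =
      Nat.dist (Fintype.card {j // (isHermitian_of_isSymm hS₀).eigenvalues j < 0})
        (Fintype.card {j // (isHermitian_of_isSymm hScs).eigenvalues j < 0}) := by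
    rw [hH]; unfold Nat.dist; omega
  rw [e]
  exact hflux

/-! ## §3 A positive definite base has totally real fibres for far letters of every rank -/

omit [DecidableEq n] in
/-- the Schur complement of a positive definite symmetric block matrix is positive definite (completion of the square,
`GramDual.form_fromBlocks` at `x = −A⁻¹By`). [folklore] -/
theorem posDef_schur'_of_posDef (A : Matrix p p ℝ) (B : Matrix p n ℝ) (D : Matrix n n ℝ) (hA : A.IsSymm) (hD : D.IsSymm)
    (hG : (fromBlocks A B Bᵀ D).PosDef) (hAdet : A.det ≠ 0) : (D - Bᵀ * A⁻¹ * B).PosDef := by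
  refine Matrix.PosDef.of_dotProduct_mulVec_pos (isHermitian_of_isSymm (isSymm_schur' A B D hA hD)) fun y hy => ?_
  have hform := form_fromBlocks hA (isUnit_iff_ne_zero.mpr hAdet) B D (-((A⁻¹ * B) *ᵥ y)) y
  rw [neg_add_cancel, Matrix.mulVec_zero, dotProduct_zero, zero_add] at hform
  have hv : Sum.elim (-((A⁻¹ * B) *ᵥ y)) y ≠ 0 := by
    intro h0
    apply hy
    funext i
    have := congrFun h0 (Sum.inr i)
    simpa using this
  have hpos := hG.dotProduct_mulVec_pos hv
  rw [star_trivial, hform] at hpos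
  rw [star_trivial]
  exact hpos

/-- **TOTALLY REAL FIBRES OVER A DEFINITE BASE, EVERY RANK.**  Far letter `0 ⊕ S₀` (`S₀` symmetric non-singular of indices `(p₀,q₀)`), base
`G = [[A,B],[Bᵀ,D]] ≻ 0` (with `det A ≠ 0`, automatic for a definite base): the fibre polynomial has exactly rank-many roots, ALL REAL —
`q₀ = ν(S₀)` positive and `p₀ = π(S₀)` negative.  No far letter of any rank folds over the definite zone of the class pencil. [this work] -/
theorem card_roots_fibre_eq_rank_of_posDef_zeroFirst (A : Matrix p p ℝ) (B : Matrix p n ℝ) (D S₀ : Matrix n n ℝ)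
    (hA : A.IsSymm) (hD : D.IsSymm) (hS₀ : S₀.IsSymm) (hG : (fromBlocks A B Bᵀ D).PosDef) (hAdet : A.det ≠ 0) (hS₀det : S₀.det ≠ 0) :
    Multiset.card (((X : ℝ[X]) • (fromBlocks (0 : Matrix p p ℝ) 0 0 S₀).map C + (fromBlocks A B Bᵀ D).map C).det).roots = Fintype.card n ∧
    Multiset.card ((((X : ℝ[X]) • (fromBlocks (0 : Matrix p p ℝ) 0 0 S₀).map C + (fromBlocks A B Bᵀ D).map C).det).roots.filter
        (fun T => 0 < T)) = Fintype.card {j // (isHermitian_of_isSymm hS₀).eigenvalues j < 0} ∧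
    Multiset.card ((((X : ℝ[X]) • (fromBlocks (0 : Matrix p p ℝ) 0 0 S₀).map C + (fromBlocks A B Bᵀ D).map C).det).roots.filter
        (fun T => T < 0)) = Fintype.card {j // 0 < (isHermitian_of_isSymm hS₀).eigenvalues j} := by
  have hScs : (D - Bᵀ * A⁻¹ * B).IsSymm := isSymm_schur' A B D hA hD
  have hScpd : (D - Bᵀ * A⁻¹ * B).PosDef := posDef_schur'_of_posDef A B D hA hD hG hAdet
  rw [det_fibre_zeroFirst_eq A B D S₀ hAdet, Polynomial.roots_C_mul _ hAdet]
  exact card_roots_fibre_eq_card_of_posDef (D - Bᵀ * A⁻¹ * B) S₀ hScpd hScs hS₀ hS₀det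

end Summit.ValiantsHypothesis.ValiantsHypothesis.Theorems.KPlusLogSqLaw.TowerGraft
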